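import Summits.BirchSwinnertonDyer.BirchSwinnertonDyer.Theorems.KolyvaginRankRigidityAtTwoChebotarevTwoLevel
import Summits.BirchSwinnertonDyer.BirchSwinnertonDyer.Theorems.KolyvaginRankRigidityAtTwoWalkCharacters
import Literature.GroupTheory.FiniteAbelian.IndependentGenerators
import HarnessLib

/-!
# Crux U1 `KolyvaginBoundedDefectAtTwo` (stmt-BirchSwinnertonDyer-28083), LINE 17 `kolyvagin_swap` v8.2, stub ES
# `EngineSupplyAtTwo` — ENGINE ADAPTER AT A DEEP READING LEVEL, I: restricted basis and killing character read on
# `Γ_{K(E[2^I])}` for classes with `E[2^k]`-coefficients, any `I ≥ k`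

Width seat `bsd-line-krr2-p2` g18 (ONE READER on LINE 17); `--supports stmt-BirchSwinnertonDyer-28083` (helper). THEOREMS
ONLY; nothing here proves ES, SWα⁗, U1, a rung or BSD. BSD is NOT proved.

The v8.2 stub ES (deep regular engine supply) asks for Kolyvagin primes of index `≥ I` with `I ≥ M + 1` ARBITRARY,
while the tree's walk engine (`WalkEngineBasis` / `WalkEngineCharacter` / `RegularValueEngineTwoLevel` /
`WalkEngineAdapter`, g14) reads the classes on `Γ_{K(E[2^(k+1)])}` and produces index `≥ k + 1` only. The reading
level enters those files ONLY as the subgroup on which restrictions are compared, so they generalise verbatim: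
* `exists_restricted_basis_deep` — g14's `exists_restricted_basis` with `Γ_{K(E[2^I])}`, `k ≤ I`, in place of
  `Γ_{K(E[2^(k+1)])}` (same proof: `h1EvalHom` restriction, `FiniteAbelian.exists_indep_generators`, lifts, matrix);
* `exists_killing_character_deep` — g14's `exists_killing_character` likewise (quotient by the span of the kept
  restrictions, `exists_addMonoidHom_zmod_pow_addOrderOf_eq_pair`).
References (locators only): [cite: McCallumLMS1991, Cor. 3.2, §3 Prop. 3.1, §5 p. 312] [cite: MazurRubin2004, §4.1,
proof of Prop. 4.1.5].
Design: no definitions; `K : Type u`; axioms `propext`, `Classical.choice`, `Quot.sound`.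
-/

set_option autoImplicit false
-- the Theorems namespace of this sub repeats the summit name by design (D-0017 nested layout)
set_option linter.dupNamespace false

noncomputable section

open scoped Classical
open Function WeierstrassCurve Field Finset
open Literature.NumberTheory.EllipticCurves Literature.NumberTheory.EllipticCurves.KolyvaginPairing
open Literature.NumberTheory.GaloisRepresentations
open Summit.BirchSwinnertonDyer.BirchSwinnertonDyer.Theorems.KolyvaginAtTwo.WalkAlgebra

namespace Summit.BirchSwinnertonDyer.BirchSwinnertonDyer.Theorems.KolyvaginAtTwo.RegularValueEngine

universe u

variable {K : Type u} [Field K] [NumberField K] (W : WeierstrassCurve ℚ)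

/-! ### §1 Restricted basis on `Γ_{K(E[2^I])}` -/

/-- **A RESTRICTED BASIS OF A FINITE `τ_*`-STABLE GROUP OF CLASSES** (input family of the value engine). For a finite
`S ≤ H¹(K, E[2^k])` with `τ_* S ⊆ S` there are `cs : Fin r → S`, a matrix `Tm` and exponents `e` with: the
restrictions of `τ_* (cs i)` and `∑ j, Tm i j • cs j` to `Γ_{K(E[2^I])}` (ANY reading level `I ≥ k`) agree; `2^(e i)` kills the restriction
of `cs i`; a combination `∑ a i • cs i` restricting to zero has `2^(e i) ∣ a i`; and every `x ∈ S` restricts like some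
`∑ a i • cs i`. [cite: McCallumLMS1991, Cor. 3.2, §5 p. 312] [cite: MazurRubin2004, §4.1] -/
theorem exists_restricted_basis_deep {k I : ℕ} (hkI : k ≤ I) (τ : K ≃ₐ[ℚ] K)
    (S : AddSubgroup (galH1Torsion (W.baseChange K) ((2 ^ k : ℕ) : ℤ))) [Finite S]
    (hSτ : ∀ x ∈ S, conjAct W τ ((2 ^ k : ℕ) : ℤ) x ∈ S) :
    ∃ (r : ℕ) (cs : Fin r → galH1Torsion (W.baseChange K) ((2 ^ k : ℕ) : ℤ)) (Tm : Fin r → Fin r → ℤ)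
      (e : Fin r → ℕ),
      (∀ i, cs i ∈ S) ∧
      (∀ i, ∀ ρ ∈ torsionFixing (W.baseChange K) ((2 ^ I : ℕ) : ℤ),
        h1Eval (W.baseChange K) ((2 ^ k : ℕ) : ℤ) (conjAct W τ ((2 ^ k : ℕ) : ℤ) (cs i)) ρ =
          h1Eval (W.baseChange K) ((2 ^ k : ℕ) : ℤ) (∑ j, Tm i j • cs j) ρ) ∧
      (∀ i, ∀ ρ ∈ torsionFixing (W.baseChange K) ((2 ^ I : ℕ) : ℤ),
        (2 : ℤ) ^ e i • h1Eval (W.baseChange K) ((2 ^ k : ℕ) : ℤ) (cs i) ρ = 0) ∧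
      (∀ a : Fin r → ℤ, (∀ ρ ∈ torsionFixing (W.baseChange K) ((2 ^ I : ℕ) : ℤ),
        h1Eval (W.baseChange K) ((2 ^ k : ℕ) : ℤ) (∑ i, a i • cs i) ρ = 0) → ∀ i, (2 : ℤ) ^ e i ∣ a i) ∧
      (∀ x ∈ S, ∃ a : Fin r → ℤ, ∀ ρ ∈ torsionFixing (W.baseChange K) ((2 ^ I : ℕ) : ℤ),
        h1Eval (W.baseChange K) ((2 ^ k : ℕ) : ℤ) x ρ =
          h1Eval (W.baseChange K) ((2 ^ k : ℕ) : ℤ) (∑ i, a i • cs i) ρ) := by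
  haveI hSfin : Finite S := inferInstance
  let n : ℤ := ((2 ^ k : ℕ) : ℤ)
  let TF := torsionFixing (W.baseChange K) ((2 ^ I : ℕ) : ℤ)
  have hle : TF ≤ torsionFixing (W.baseChange K) n :=
    KolyvaginLowerBoundAtTwo.torsionFixing_le_of_dvd _ (by simp only [n]; exact_mod_cast Nat.pow_dvd_pow 2 hkI)
  -- the restriction homomorphism
  let res : galH1Torsion (W.baseChange K) n →+ (TF → geomTorsion (W.baseChange K) n) :=
    AddMonoidHom.pi fun ρ : TF ↦ h1EvalHom (W.baseChange K) n (hle ρ.2)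
  have hres : ∀ x (ρ : TF), res x ρ = h1Eval (W.baseChange K) n x ρ := fun _ _ ↦ rfl
  have hres' : ∀ x y : galH1Torsion (W.baseChange K) n,
      res x = res y ↔ ∀ ρ ∈ TF, h1Eval (W.baseChange K) n x ρ = h1Eval (W.baseChange K) n y ρ := fun x y ↦ by
    constructor
    · intro h ρ hρ
      have := congrFun h ⟨ρ, hρ⟩
      rwa [hres, hres] at this
    · intro h
      funext ρ
      rw [hres, hres]
      exact h ρ ρ.2
  -- the finite group `G = res(S)` and its independent generators
  set G := S.map res with hG
  haveI : Finite G := by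
    refine Finite.of_surjective (fun x : ↥S ↦ (⟨res x, AddSubgroup.mem_map_of_mem res x.2⟩ : G)) ?_
    rintro ⟨y, hy⟩
    obtain ⟨x, hx, rfl⟩ := AddSubgroup.mem_map.mp hy
    exact ⟨⟨x, hx⟩, rfl⟩
  obtain ⟨ι, _, g, hind, hgen⟩ := Literature.GroupTheory.FiniteAbelian.exists_indep_generators (G := G)
  -- reindex by `Fin r`
  set r := Fintype.card ι with hr
  let σ : ι ≃ Fin r := Fintype.equivFin ι
  let g' : Fin r → G := fun j ↦ g (σ.symm j)
  have hind' : ∀ a : Fin r → ℤ, ∑ j, a j • g' j = 0 → ∀ j, (addOrderOf (g' j) : ℤ) ∣ a j := by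
    intro a ha j
    have h := hind (fun i ↦ a (σ i)) (by
      rw [← ha, ← Equiv.sum_comp σ.symm]
      exact Finset.sum_congr rfl fun j _ ↦ by rw [Equiv.apply_symm_apply])
    have := h (σ.symm j)
    rwa [Equiv.apply_symm_apply] at this
  have hgen' : ∀ x : G, ∃ a : Fin r → ℤ, x = ∑ j, a j • g' j := by
    intro x
    obtain ⟨a, ha⟩ := hgen x
    refine ⟨fun j ↦ a (σ.symm j), ?_⟩
    rw [ha, ← Equiv.sum_comp σ.symm]
  -- lifts of the generators
  have hlift : ∀ j, ∃ c ∈ S, res c = (g' j : TF → geomTorsion (W.baseChange K) n) :=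
    fun j ↦ AddSubgroup.mem_map.mp (g' j).2
  choose cs hcsS hcs using hlift
  -- orders are powers of two
  have h2k : ∀ x : G, (2 ^ k) • x = 0 := by
    intro x
    apply Subtype.ext
    rw [AddSubgroup.coe_nsmul, AddSubgroup.coe_zero]
    funext ρ
    rw [Pi.smul_apply, Pi.zero_apply]
    have := (W.baseChange K).natAbs_nsmul_geomTorsion ((x : TF → geomTorsion (W.baseChange K) n) ρ)
    rwa [Int.natAbs_natCast] at this
  have he : ∀ j, ∃ e : ℕ, e ≤ k ∧ addOrderOf (g' j) = 2 ^ e :=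
    fun j ↦ (Nat.dvd_prime_pow Nat.prime_two).mp (addOrderOf_dvd_of_nsmul_eq_zero (h2k (g' j)))
  choose e _ he using he
  -- the matrix of `τ_*`
  have hTm : ∀ i, ∃ a : Fin r → ℤ,
      (⟨res (conjAct W τ n (cs i)), AddSubgroup.mem_map_of_mem res (hSτ _ (hcsS i))⟩ : G) = ∑ j, a j • g' j :=
    fun i ↦ hgen' ⟨res (conjAct W τ n (cs i)), AddSubgroup.mem_map_of_mem res (hSτ _ (hcsS i))⟩
  choose Tm hTm using hTm
  -- sums of lifts restrict to sums of generators
  have hsum : ∀ a : Fin r → ℤ, res (∑ j, a j • cs j) = ((∑ j, a j • g' j : G) : TF → geomTorsion (W.baseChange K) n) := by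
    intro a
    rw [map_sum, AddSubgroup.val_finsetSum]
    refine Finset.sum_congr rfl fun j _ ↦ ?_
    rw [map_zsmul, AddSubgroup.coe_zsmul, hcs]
  refine ⟨r, cs, Tm, e, hcsS, fun i ρ hρ ↦ ?_, fun i ρ hρ ↦ ?_, fun a ha i ↦ ?_, fun x hx ↦ ?_⟩
  · -- `hT`
    have h := congrArg (fun y : G ↦ (y : TF → geomTorsion (W.baseChange K) n) ⟨ρ, hρ⟩) (hTm i)
    simp only at h
    rw [← hsum, hres, hres] at h
    exact h
  · -- `he`
    have h := addOrderOf_nsmul_eq_zero (g' i)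
    rw [he i] at h
    have h' := congrArg (fun y : G ↦ (y : TF → geomTorsion (W.baseChange K) n) ⟨ρ, hρ⟩) h
    simp only [AddSubgroup.coe_nsmul, Pi.smul_apply, AddSubgroup.coe_zero, Pi.zero_apply] at h'
    rw [← hcs, hres] at h'
    rw [← natCast_zsmul, Nat.cast_pow, Nat.cast_ofNat] at h'
    exact h'
  · -- `hind`
    have h0 : (∑ j, a j • g' j : G) = 0 := by
      apply Subtype.ext
      rw [← hsum, AddSubgroup.coe_zero]
      funext ρ
      rw [hres, Pi.zero_apply]
      exact ha ρ ρ.2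
    have h := hind' a h0 i
    rw [he i] at h
    exact_mod_cast h
  · -- spanning
    obtain ⟨a, ha⟩ := hgen' ⟨res x, AddSubgroup.mem_map_of_mem res hx⟩
    refine ⟨a, fun ρ hρ ↦ ?_⟩
    have h := congrArg (fun y : G ↦ (y : TF → geomTorsion (W.baseChange K) n) ⟨ρ, hρ⟩) ha
    simp only at h
    rw [← hsum, hres, hres] at h
    exact h

/-! ### §2 Killing character on `Γ_{K(E[2^I])}` -/

/-- **THE KILLING CHARACTER OF A WALK STEP.** `S ≤ H¹(K, E[2^k])`, classes `y i ∈ S` (to be killed), `p, q ∈ S`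
(the cutters). There is an additive `f : S → ZMod 2^k` which (1) only depends on the restriction to
`Γ_{K(E[2^I])}` (ANY reading level `I ≥ k`), (2) kills every `y i`, and (3) for `x = p` and `x = q`: `a • f x = 0` iff `a • x` restricts like an
integer combination of the `y i` (so `addOrderOf (f x)` is the order of `x` in `res(S)/⟨res y⟩`).
[cite: MazurRubin2004, §4.1, proof of Prop. 4.1.5] [cite: McCallumLMS1991, §3 Prop. 3.1] -/
theorem exists_killing_character_deep {k I : ℕ} (hkI : k ≤ I) (S : AddSubgroup (galH1Torsion (W.baseChange K) ((2 ^ k : ℕ) : ℤ)))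
    {m : ℕ} (y : Fin m → galH1Torsion (W.baseChange K) ((2 ^ k : ℕ) : ℤ)) (hy : ∀ i, y i ∈ S)
    {p q : galH1Torsion (W.baseChange K) ((2 ^ k : ℕ) : ℤ)} (hp : p ∈ S) (hq : q ∈ S) :
    ∃ f : S →+ ZMod (2 ^ k),
      (∀ x x' : S, (∀ ρ ∈ torsionFixing (W.baseChange K) ((2 ^ I : ℕ) : ℤ),
        h1Eval (W.baseChange K) ((2 ^ k : ℕ) : ℤ) (x : galH1Torsion (W.baseChange K) ((2 ^ k : ℕ) : ℤ)) ρ =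
          h1Eval (W.baseChange K) ((2 ^ k : ℕ) : ℤ) (x' : galH1Torsion (W.baseChange K) ((2 ^ k : ℕ) : ℤ)) ρ) →
        f x = f x') ∧
      (∀ i, f ⟨y i, hy i⟩ = 0) ∧
      (∀ a : ℤ, a • f ⟨p, hp⟩ = 0 ↔ ∃ b : Fin m → ℤ, ∀ ρ ∈ torsionFixing (W.baseChange K) ((2 ^ I : ℕ) : ℤ),
        h1Eval (W.baseChange K) ((2 ^ k : ℕ) : ℤ) (a • p - ∑ i, b i • y i) ρ = 0) ∧
      (∀ a : ℤ, a • f ⟨q, hq⟩ = 0 ↔ ∃ b : Fin m → ℤ, ∀ ρ ∈ torsionFixing (W.baseChange K) ((2 ^ I : ℕ) : ℤ),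
        h1Eval (W.baseChange K) ((2 ^ k : ℕ) : ℤ) (a • q - ∑ i, b i • y i) ρ = 0) := by
  let n : ℤ := ((2 ^ k : ℕ) : ℤ)
  let TF := torsionFixing (W.baseChange K) ((2 ^ I : ℕ) : ℤ)
  have hle : TF ≤ torsionFixing (W.baseChange K) n :=
    KolyvaginLowerBoundAtTwo.torsionFixing_le_of_dvd _ (by simp only [n]; exact_mod_cast Nat.pow_dvd_pow 2 hkI)
  -- restriction, span of the `res (y i)`, quotient
  let res : galH1Torsion (W.baseChange K) n →+ (TF → geomTorsion (W.baseChange K) n) :=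
    AddMonoidHom.pi fun ρ : TF ↦ h1EvalHom (W.baseChange K) n (hle ρ.2)
  have hres : ∀ x (ρ : TF), res x ρ = h1Eval (W.baseChange K) n x ρ := fun _ _ ↦ rfl
  have hres0 : ∀ x : galH1Torsion (W.baseChange K) n,
      res x = 0 ↔ ∀ ρ ∈ TF, h1Eval (W.baseChange K) n x ρ = 0 := fun x ↦ by
    constructor
    · intro h ρ hρ
      have := congrFun h ⟨ρ, hρ⟩
      rwa [hres] at this
    · intro h
      funext ρ
      rw [hres, Pi.zero_apply]
      exact h ρ ρ.2
  let B : (Fin m → ℤ) →+ (TF → geomTorsion (W.baseChange K) n) :=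
    { toFun := fun b ↦ ∑ i, b i • res (y i)
      map_zero' := by simp
      map_add' := fun b b' ↦ by
        simp only [Pi.add_apply, add_smul]
        exact Finset.sum_add_distrib }
  have hB : ∀ b, B b = ∑ i, b i • res (y i) := fun _ ↦ rfl
  let H := B.range
  let φ : galH1Torsion (W.baseChange K) n →+ (TF → geomTorsion (W.baseChange K) n) ⧸ H :=
    (QuotientAddGroup.mk' H).comp res
  have hφ : ∀ x, φ x = 0 ↔ ∃ b : Fin m → ℤ, res x = ∑ i, b i • res (y i) := fun x ↦ by
    change ((res x : (TF → geomTorsion (W.baseChange K) n) ⧸ H) : _) = 0 ↔ _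
    rw [QuotientAddGroup.eq_zero_iff]
    constructor
    · rintro ⟨b, hb⟩; exact ⟨b, by rw [← hb, hB]⟩
    · rintro ⟨b, hb⟩; exact ⟨b, by rw [hB, hb]⟩
  -- the character on the finite `2^k`-torsion group `φ(S)`
  let ψ : S →+ S.map φ := φ.addSubgroupMap S
  have hψ : ∀ x : S, (ψ x : (TF → geomTorsion (W.baseChange K) n) ⧸ H) = φ x := fun _ ↦ rfl
  have h2k : ∀ g : S.map φ, 2 ^ k • g = 0 := by
    rintro ⟨_, x, hx, rfl⟩
    apply Subtype.ext
    rw [AddSubgroup.coe_nsmul, AddSubgroup.coe_zero, ← map_nsmul]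
    have h0 : (2 ^ k) • res x = 0 := by
      funext ρ
      rw [Pi.smul_apply, Pi.zero_apply]
      have := (W.baseChange K).natAbs_nsmul_geomTorsion (res x ρ)
      rwa [Int.natAbs_natCast] at this
    change QuotientAddGroup.mk' H (res ((2 ^ k) • x)) = 0
    rw [map_nsmul, h0, map_zero]
  obtain ⟨χ, hχp, hχq⟩ := exists_addMonoidHom_zmod_pow_addOrderOf_eq_pair h2k (ψ ⟨p, hp⟩) (ψ ⟨q, hq⟩)
  -- translation of `a • χ (ψ x) = 0`
  have hkey : ∀ (x : galH1Torsion (W.baseChange K) n) (hx : x ∈ S),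
      addOrderOf (χ (ψ ⟨x, hx⟩)) = addOrderOf (ψ ⟨x, hx⟩) →
      ∀ a : ℤ, a • χ (ψ ⟨x, hx⟩) = 0 ↔ ∃ b : Fin m → ℤ, ∀ ρ ∈ TF,
        h1Eval (W.baseChange K) n (a • x - ∑ i, b i • y i) ρ = 0 := by
    intro x hx hord a
    rw [← addOrderOf_dvd_iff_zsmul_eq_zero, hord, addOrderOf_dvd_iff_zsmul_eq_zero, ← map_zsmul]
    have e1 : (ψ (a • ⟨x, hx⟩) = 0) ↔ φ (a • x) = 0 := by
      constructor
      · intro h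
        have h' := congrArg Subtype.val h
        rw [hψ, AddSubgroup.coe_zero, AddSubgroup.coe_zsmul] at h'
        exact h'
      · intro h
        exact Subtype.ext (by rw [hψ, AddSubgroup.coe_zero, AddSubgroup.coe_zsmul]; exact h)
    rw [e1, hφ]
    refine exists_congr fun b ↦ ?_
    rw [← sub_eq_zero, ← hres0, map_sub, map_sum]
    simp only [map_zsmul]
  refine ⟨χ.comp ψ, fun x x' hxx' ↦ ?_, fun i ↦ ?_, hkey p hp hχp, hkey q hq hχq⟩
  · -- factors through the restriction
    have hr : res (x : galH1Torsion (W.baseChange K) n) = res (x' : galH1Torsion (W.baseChange K) n) := by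
      funext ρ
      rw [hres, hres]
      exact hxx' ρ ρ.2
    have : ψ x = ψ x' := Subtype.ext (by rw [hψ, hψ]; change QuotientAddGroup.mk' H (res x) = _; rw [hr]; rfl)
    rw [AddMonoidHom.comp_apply, AddMonoidHom.comp_apply, this]
  · -- kills `y i`
    have : ψ ⟨y i, hy i⟩ = 0 := by
      apply Subtype.ext
      rw [hψ, AddSubgroup.coe_zero]
      exact (hφ _).mpr ⟨Pi.single i 1, by simp [Pi.single_apply]⟩
    rw [AddMonoidHom.comp_apply, this, map_zero]

end Summit.BirchSwinnertonDyer.BirchSwinnertonDyer.Theorems.KolyvaginAtTwo.RegularValueEngine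

end
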